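import Literature.MathematicalPhysics.QuantumFieldTheory.Balaban1983to89.B9Eq342TowerValueRowMajorant
import Literature.MathematicalPhysics.QuantumFieldTheory.Balaban1983to89.B9Eq342TowerAdjointRowMajorant

/-!
# `Balaban1983to89.B9Eq342TowerFlatBaseMajorants` — T. Bałaban, *Propagators for lattice gauge theories in a background field*, Commun. Math. Phys. **99** (1985) 389–434
# [Balaban1985BackgroundPropagators] Thm 3.1 (3.42)₁₋₃ p. 397 AT THE FLAT BACKGROUND, with Thm 3.4 p. 400 («We assume that Theorem 3.1 is valid for the operator G′(U)», p. 402):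
# **THE THREE THEOREM-3.1 INPUTS OF THE SECT. B PROGRAMME AT THE NE9 CHAIN's FLAT `k`-LEVEL SITE PROPAGATOR `G′_k(1)`, AT COMMON CONSTANTS** — `h342_1`, `h342_2`, `h342_3` of
# `B9Thm34SectBUniform(R1).thm34_Gp_uniform` for `Gp := conj b (readA φ G′_k(1))` over `towerGeom`, base transports `U ≡ 1`, with ONE `(B_G, δ₀)` BEFORE the height: this lineage's
# (j4)₁₋₃ (`B9Eq342TowerValueRowMajorant`, `B9Eq342TowerGradientRowMajorant`, `B9Eq342TowerAdjointRowMajorant`) at the vacuum, which is in the chain's class at `α = 0`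
# (`ε_j ≡ 0`, `Ū^j ≡ 1`), and the rates ∕ constants merged (`min` ∕ sum); junction item (j4) of the NE9 lineage's route memo `ROUTE-J-VIA-THM34-g98.md`, flat base

statement-level skeleton of published theorems with citation tags; proofs where landed; nothing here is a claim about the Yang–Mills mass gap

CITATION HEADER (lean-in-tree rule).  Audit cell `pub-balaban`, sub-cell `t4`, BINDER row NE9; NE9 crux-team LEAF PROVER 01 (`b2b-balaban-t4-ne9-formalise-leaf-01`,
gen 99; bears_on: R4/N22).  Vocabulary BY NAME: this lineage's `exists_hasMajorant_GpOfUk` ∕ `exists_hasMajorant_diffLetter_GpOfUk` ∕ `exists_hasMajorant_GpOfUk_diffLetter` (the OWNER's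
and this lineage's rows of (3.42)₁₋₃ on the cell's MODEL), `B9Eq315QTowerFlat.UlevOf_one`, `B5Eq172HodgePositivity.adTransportW_one`, `B7Prop1Explicit.U1`, pv08's
`B6RandomWalk.hasMajorant_mono`.  Sources read through those files' verbatim quotations: [Balaban1985BackgroundPropagators] p. 397 Thm 3.1 (3.42), p. 400 Thm 3.4, p. 402.  [folklore]
COMPOSITION BY NAME; NOTHING of print's proofs is reproduced.

WHAT IS PROVED (sorry-free; proof lane — no `def`).
* §1 the vacuum is in the class: `hRS_flat_tower`, `norm_one_sub_one_le`, `UlevOf_one_norm_sub_one_le`, `UlevOf_one_mem_U1`, `star_one_eq_inv_one`, `norm_adTransportW_UlevOf_one_le`,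
  `norm_one_sub_one_unshift_le` (rate ∕ constant merging by `B4Sect5Proof.weaken`).
* §2 **`exists_hasMajorants_GpOfUk_one`** — `∃ B_G δ₀ > 0` BEFORE the height such that at every height on print's diagonal, every period, ANY positivity witness of `Δ′_{a′,k}(1)`, ANY `M, R_r, H`:
  `h342_1 ∧ (∀ k, h342_2 k) ∧ (∀ l, h342_3 l)` for `Gp := conj b (readA φ (G′_k(1)))`, `T μ := shiftEquiv μ`, `U ≡ 1`, kernels `B_G·len²·e^{−δ₀d}` ∕ `B_G·len·e^{−δ₀d}` (`1 ≤ d`, `3 ≤ L`).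
HONEST SCOPE.  Composition; the rows are the cell's MODEL of (3.42) («NE9 ⇐ the named binders»; O-NE9-1, #5 UNRULED); constants crude; NE9 NOT PRINTED ∕ NOT PROVED; spine PROVED 0∕9;
rung (B)+1 finite T⁴ — NOT infinite volume, NOT mass gap, NOT BetaPertH, NOT Clay.  HONEST DEPENDENCY: continuum YM on T⁴ ⇐ BetaPertH ∧ nine spine estimates (0/9 proved); BetaPertH ⇐
(D1) ∧ (D4) ∧ CAP+tail; G-an2-4 gates asym, D1 and NE2/3/4.  NEW file; nothing modified.  Net new unproved facts: 0.
-/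

noncomputable section

open scoped BigOperators InnerProductSpace

namespace Literature.MathematicalPhysics.QuantumFieldTheory.Balaban1983to89.B9Eq342TowerFlatBaseMajorants

open B4Sect5Torus (TSite)
open B7Prop1Explicit (U1)
open B9SectCLatticeCarrier (Bond unshift)
open B9Eq311L2Pairing (WL2)
open B11Eq103H1Complex (SiteL2K)
open B9Eq310HessianOperator (adTransportW)
open B9Eq315QTower (towerP UlevOf)
open B9Eq324DeltaPrimeATower (laplacePrimeAk GpOfUk)
open B6RandomWalk (HasMajorant hasMajorant_mono)
open B9Thm34Ext (toB6)
open B9Eq33CovDerivVector (shiftEquiv)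
open B9Eq352DivFormLetters (conj)
open B9Eq352GradLetters (diffLetter)
open B9Eq324PenaltyKernelForm (readA)
open B9Eq357QprimeTowerKernelForm (blkK)
open B9Eq341TowerBlockGeometry (towerGeom hdnn_towerGeom)
open B9Eq342TowerValueRowMajorant (exists_hasMajorant_GpOfUk)
open B9Eq342TowerGradientRowMajorant (exists_hasMajorant_diffLetter_GpOfUk)
open B9Eq342TowerAdjointRowMajorant (exists_hasMajorant_GpOfUk_diffLetter)

/-! ## §1 The vacuum is in the chain's class -/

section Flat

variable {d : ℕ} (L : ℕ) (m : Fin d → ℕ) (n : ℕ) {𝔸 : Type*}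

/-- Mutual adjointness `hRS` at the flat background (both transporter families are the identity). [cite: Balaban1985BackgroundPropagators, (3.5) p.391] -/
theorem hRS_flat_tower [NormedRing 𝔸] [NormedAlgebra ℂ 𝔸] {W : Type*} [NormedAddCommGroup W] [InnerProductSpace ℂ W] (φ : W ≃ₗ[ℂ] 𝔸) :
    ∀ (bd : Bond d (towerP L m (n + 1))) (v u : W),
    ⟪adTransportW φ (fun _ : Bond d (towerP L m (n + 1)) => (1 : 𝔸ˣ)) bd v, u⟫_ℂ =
      ⟪v, adTransportW φ (fun bd => ((fun _ : Bond d (towerP L m (n + 1)) => (1 : 𝔸ˣ)) bd)⁻¹) bd u⟫_ℂ := by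
  intro bd v u
  have h1 : (fun bd : Bond d (towerP L m (n + 1)) => ((fun _ : Bond d (towerP L m (n + 1)) => (1 : 𝔸ˣ)) bd)⁻¹) =
      fun _ => (1 : 𝔸ˣ) := funext fun _ => inv_one
  rw [h1, B5Eq172HodgePositivity.adTransportW_one, LinearMap.id_apply, LinearMap.id_apply]

/-- `‖1 − 1‖ ≤ 0·η`. [folklore] [cite: Balaban1985BackgroundPropagators, (3.35) p.396] -/
theorem norm_one_sub_one_le [NormedRing 𝔸] (η : ℝ) : ∀ bd : Bond d (towerP L m (n + 1)), ‖(((fun _ : Bond d (towerP L m (n + 1)) => (1 : 𝔸ˣ)) bd : 𝔸ˣ) : 𝔸) - 1‖ ≤ 0 * η :=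
  fun _ => by simp

/-- The bond-gradient datum at the vacuum: `‖1 − 1‖ ≤ 0·η²`. [folklore] [cite: Balaban1985BackgroundPropagators, (3.35) p.396] -/
theorem norm_one_sub_one_unshift_le [NormedRing 𝔸] (η : ℝ) : ∀ (x : TSite d (towerP L m (n + 1))) (μ : Fin d),
    ‖(((fun _ : Bond d (towerP L m (n + 1)) => (1 : 𝔸ˣ)) (x, μ) : 𝔸ˣ) : 𝔸) - (((fun _ : Bond d (towerP L m (n + 1)) => (1 : 𝔸ˣ)) (unshift μ x, μ) : 𝔸ˣ) : 𝔸)‖ ≤ 0 * η ^ 2 :=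
  fun _ _ => by simp

/-- The level averages of the vacuum are the vacuum: `‖Ū^j(1)(b) − 1‖ ≤ 0`. [cite: Balaban1985Averaging, (42)–(43) p.23; Balaban1985BackgroundPropagators, (3.15) p.393] -/
theorem UlevOf_one_norm_sub_one_le [NeZero L] [∀ i, NeZero (m i)] [NormedRing 𝔸] [NormedAlgebra ℂ 𝔸] [CompleteSpace 𝔸] [NormOneClass 𝔸] : ∀ (j : ℕ) (bd : Bond d (towerP L m (j + 1))),
    ‖(UlevOf L m (n + 1) (fun _ : Bond d (towerP L m (n + 1)) => (1 : 𝔸ˣ)) j bd : 𝔸) - 1‖ ≤ (fun _ : ℕ => (0 : ℝ)) j := fun j bd => by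
  rw [B9Eq315QTowerFlat.UlevOf_one]; simp

/-- The level averages of the vacuum are in `U1`. [cite: Balaban1985Averaging, (42)–(43) p.23] -/
theorem UlevOf_one_mem_U1 [NeZero L] [∀ i, NeZero (m i)] [NormedRing 𝔸] [NormedAlgebra ℂ 𝔸] [CompleteSpace 𝔸] [NormOneClass 𝔸] : ∀ (j : ℕ) (bd : Bond d (towerP L m (j + 1))), UlevOf L m (n + 1) (fun _ : Bond d (towerP L m (n + 1)) => (1 : 𝔸ˣ)) j bd ∈ U1 𝔸 :=
  fun j bd => by rw [B9Eq315QTowerFlat.UlevOf_one]; exact one_mem _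

/-- `star 1 = 1⁻¹`. [folklore] [cite: Balaban1985BackgroundPropagators, (3.5) p.391] -/
theorem star_one_eq_inv_one [NormedRing 𝔸] [StarRing 𝔸] : ∀ bd : Bond d (towerP L m (n + 1)),
    star (((fun _ : Bond d (towerP L m (n + 1)) => (1 : 𝔸ˣ)) bd : 𝔸ˣ) : 𝔸) = ((((fun _ : Bond d (towerP L m (n + 1)) => (1 : 𝔸ˣ)) bd)⁻¹ : 𝔸ˣ) : 𝔸) :=
  fun _ => by simp

/-- The level transporters of the vacuum are contractions (identities). [cite: Balaban1985BackgroundPropagators, (3.19) p.393] -/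
theorem norm_adTransportW_UlevOf_one_le [NeZero L] [∀ i, NeZero (m i)] [NormedRing 𝔸] [NormedAlgebra ℂ 𝔸] [CompleteSpace 𝔸] [NormOneClass 𝔸]
    {W : Type*} [NormedAddCommGroup W] [InnerProductSpace ℂ W] (φ : W ≃ₗ[ℂ] 𝔸) : ∀ (j : ℕ) (bd : Bond d (towerP L m (j + 1))) (w : W),
    ‖adTransportW φ (UlevOf L m (n + 1) (fun _ : Bond d (towerP L m (n + 1)) => (1 : 𝔸ˣ)) j) bd w‖ ≤ ‖w‖ := fun j bd w => by
  rw [B9Eq315QTowerFlat.UlevOf_one, B5Eq172HodgePositivity.adTransportW_one, LinearMap.id_apply]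

end Flat

/-! ## §2 The three inputs at the flat base, common constants -/

section Main

variable {d : ℕ} (L : ℕ) [NeZero L] {𝔸 : Type*} [NormedRing 𝔸] [NormedAlgebra ℂ 𝔸] [CompleteSpace 𝔸] [NormOneClass 𝔸] [StarRing 𝔸]
  {W : Type*} [NormedAddCommGroup W] [InnerProductSpace ℂ W] [FiniteDimensional ℂ W] (φ : W ≃ₗ[ℂ] 𝔸) {a' Mφ Mφ' : ℝ}
  (hMφ : 0 ≤ Mφ) (hMφ' : 0 ≤ Mφ') (hφn : ∀ w, ‖φ w‖ ≤ Mφ * ‖w‖) (hφn' : ∀ X, ‖φ.symm X‖ ≤ Mφ' * ‖X‖) (ha' : 0 < a')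
  (τ : 𝔸 →ₗ[ℂ] ℂ) (hτ₂ : ∀ X Y : 𝔸, τ (X * Y) = τ (Y * X)) (hφτ : ∀ X Y : 𝔸, ⟪φ.symm X, φ.symm Y⟫_ℂ = τ (star X * Y))
  {ι : Type} [Fintype ι] (b : Module.Basis ι ℝ 𝔸) {M₂ : ℝ} (hM₂ : 0 ≤ M₂) (hrepr : ∀ (v : 𝔸) (i : ι), |b.repr v i| ≤ M₂ * ‖v‖)

include hMφ hMφ' hφn hφn' ha' hτ₂ hφτ hM₂ hrepr in
/-- **THE THREE THEOREM-3.1 INPUTS OF `thm34_Gp_uniform` AT THE CHAIN's FLAT `G′_k(1)`, COMMON CONSTANTS BEFORE THE HEIGHT** — see the module docstring.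
[cite: Balaban1985BackgroundPropagators, Thm 3.1 (3.42) p.397, Thm 3.4 p.400, p.402; Balaban1984PropagatorsII, (2.51) p.232] -/
theorem exists_hasMajorants_GpOfUk_one (hd : 1 ≤ d) (hL3 : 3 ≤ L) :
    ∃ BG δ₀ : ℝ, 0 < BG ∧ 0 < δ₀ ∧
      ∀ (n : ℕ) (η : ℝ), η * (L : ℝ) ^ (n + 1) = 1 →
      ∀ (c₀ c₁ : ℝ) [Fact (0 < c₀)] [Fact (0 < c₁)], c₀ * ((L : ℝ) ^ (n + 1)) ^ d = c₁ →
      ∀ (m : Fin d → ℕ) [∀ i, NeZero (m i)]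
        (hpos₁ : ∀ x : SiteL2K ℂ d (towerP L m (n + 1)) c₀ W, x ≠ 0 →
          0 < RCLike.re ⟪x, laplacePrimeAk L m n φ η (fun _ : Bond d (towerP L m (n + 1)) => (1 : 𝔸ˣ)) a' (c₁ := c₁) x⟫_ℂ)
        (M Rr : ℝ) (H : Prop),
      HasMajorant (g := toB6 (towerGeom L m n η M) Rr H) (fun p : TSite d (towerP L m (n + 1)) × ι => blkK L m n p.1)
          (conj b (readA φ (GpOfUk L m n φ η (fun _ : Bond d (towerP L m (n + 1)) => (1 : 𝔸ˣ)) a' (c₁ := c₁) hpos₁)))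
          (fun a a' => BG * (towerGeom L m n η M).len a ^ 2 * Real.exp (-(δ₀ * (towerGeom L m n η M).dist a a'))) ∧
      (∀ k : Fin d ⊕ Fin d,
        HasMajorant (g := toB6 (towerGeom L m n η M) Rr H) (fun p : TSite d (towerP L m (n + 1)) × ι => blkK L m n p.1)
          (conj b (diffLetter (fun μ => shiftEquiv (Pd := towerP L m (n + 1)) μ)
              (fun μ y => (fun _ : Bond d (towerP L m (n + 1)) => (1 : 𝔸ˣ)) (y, μ)) ((η : ℂ))⁻¹ k) *
            conj b (readA φ (GpOfUk L m n φ η (fun _ : Bond d (towerP L m (n + 1)) => (1 : 𝔸ˣ)) a' (c₁ := c₁) hpos₁)))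
          (fun a a' => BG * (towerGeom L m n η M).len a * Real.exp (-(δ₀ * (towerGeom L m n η M).dist a a')))) ∧
      (∀ l : Fin d ⊕ Fin d,
        HasMajorant (g := toB6 (towerGeom L m n η M) Rr H) (fun p : TSite d (towerP L m (n + 1)) × ι => blkK L m n p.1)
          (conj b (readA φ (GpOfUk L m n φ η (fun _ : Bond d (towerP L m (n + 1)) => (1 : 𝔸ˣ)) a' (c₁ := c₁) hpos₁)) *
            conj b (diffLetter (fun μ => shiftEquiv (Pd := towerP L m (n + 1)) μ)
              (fun μ y => (fun _ : Bond d (towerP L m (n + 1)) => (1 : 𝔸ˣ)) (y, μ)) ((η : ℂ))⁻¹ l))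
          (fun a a' => BG * (towerGeom L m n η M).len a * Real.exp (-(δ₀ * (towerGeom L m n η M).dist a a')))) := by
  have hL2 : 2 ≤ L := le_trans (by norm_num) hL3
  -- a geometric profile is irrelevant at the vacuum (`ε_j ≡ 0`); take `r := 0`
  obtain ⟨α₁, B₁, δ₁, hα₁, hB₁, hδ₁, h1⟩ := exists_hasMajorant_GpOfUk L φ (a' := a') hMφ hMφ' hφn hφn' ha' (r := 0) le_rfl zero_lt_one τ hτ₂ hφτ b hM₂ hrepr hd
  obtain ⟨α₂, B₂, δ₂, hα₂, hB₂, hδ₂, h2⟩ :=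
    exists_hasMajorant_diffLetter_GpOfUk L φ (a' := a') hMφ hMφ' hφn hφn' ha' (r := 0) le_rfl zero_lt_one τ hτ₂ hφτ b hM₂ hrepr hd hL2
  obtain ⟨α₃, B₃, δ₃, hα₃, hB₃, hδ₃, h3⟩ :=
    exists_hasMajorant_GpOfUk_diffLetter L φ (a' := a') hMφ hMφ' hφn hφn' ha' (r := 0) le_rfl zero_lt_one τ hτ₂ hφτ b hM₂ hrepr hd hL3
  refine ⟨B₁ + B₂ + B₃, min δ₁ (min δ₂ δ₃), by positivity, lt_min hδ₁ (lt_min hδ₂ hδ₃), ?_⟩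
  intro n η hηL c₀ c₁ _ _ hdiag m _ hpos₁ M Rr H
  set V1 : Bond d (towerP L m (n + 1)) → 𝔸ˣ := fun _ => 1 with hV1
  have hδm₁ : min δ₁ (min δ₂ δ₃) ≤ δ₁ := min_le_left _ _
  have hδm₂ : min δ₁ (min δ₂ δ₃) ≤ δ₂ := (min_le_right _ _).trans (min_le_left _ _)
  have hδm₃ : min δ₁ (min δ₂ δ₃) ≤ δ₃ := (min_le_right _ _).trans (min_le_right _ _)
  refine ⟨?_, fun k => ?_, fun l => ?_⟩
  · have h := h1 n η hηL c₀ c₁ hdiag m V1 (hRS_flat_tower L m n φ) 0 le_rfl hα₁.le (fun _ => one_mem _) (norm_one_sub_one_le L m n η)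
      (fun _ => 0) (fun _ => le_rfl) (fun _ _ => by simp) (UlevOf_one_norm_sub_one_le L m n) (UlevOf_one_mem_U1 L m n) (star_one_eq_inv_one L m n)
      (norm_adTransportW_UlevOf_one_le L m n φ) hpos₁ M Rr H
    refine hasMajorant_mono _ h fun a a'' => ?_
    have hl : 0 ≤ (towerGeom L m n η M).len a ^ 2 := sq_nonneg _
    calc B₁ * (towerGeom L m n η M).len a ^ 2 * Real.exp (-(δ₁ * (towerGeom L m n η M).dist a a''))
        = (towerGeom L m n η M).len a ^ 2 * (B₁ * Real.exp (-(δ₁ * (towerGeom L m n η M).dist a a''))) := by ring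
      _ ≤ (towerGeom L m n η M).len a ^ 2 * ((B₁ + B₂ + B₃) * Real.exp (-(min δ₁ (min δ₂ δ₃) * (towerGeom L m n η M).dist a a''))) :=
          mul_le_mul_of_nonneg_left (B4Sect5Proof.weaken hB₁.le (by linarith) hδm₁ (hdnn_towerGeom L m n η M a a'')) hl
      _ = (B₁ + B₂ + B₃) * (towerGeom L m n η M).len a ^ 2 * Real.exp (-(min δ₁ (min δ₂ δ₃) * (towerGeom L m n η M).dist a a'')) := by ring
  · have h := h2 n η hηL c₀ c₁ hdiag m V1 (hRS_flat_tower L m n φ) 0 le_rfl hα₂.le (fun _ => one_mem _) (norm_one_sub_one_le L m n η)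
      (norm_one_sub_one_unshift_le L m n η) (fun _ => 0) (fun _ => le_rfl) (fun _ _ => by simp) (UlevOf_one_norm_sub_one_le L m n) (UlevOf_one_mem_U1 L m n)
      (star_one_eq_inv_one L m n) (norm_adTransportW_UlevOf_one_le L m n φ) hpos₁ M Rr H k
    refine hasMajorant_mono _ h fun a a'' => ?_
    have hl : 0 ≤ (towerGeom L m n η M).len a :=
      (B9Eq341TowerBlockGeometry.hlen_towerGeom L m n η M (by nlinarith [hηL, pow_pos (show (0 : ℝ) < L by exact_mod_cast Nat.pos_of_ne_zero (NeZero.ne L)) (n + 1)]) a).le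
    calc B₂ * (towerGeom L m n η M).len a * Real.exp (-(δ₂ * (towerGeom L m n η M).dist a a''))
        = (towerGeom L m n η M).len a * (B₂ * Real.exp (-(δ₂ * (towerGeom L m n η M).dist a a''))) := by ring
      _ ≤ (towerGeom L m n η M).len a * ((B₁ + B₂ + B₃) * Real.exp (-(min δ₁ (min δ₂ δ₃) * (towerGeom L m n η M).dist a a''))) :=
          mul_le_mul_of_nonneg_left (B4Sect5Proof.weaken hB₂.le (by linarith) hδm₂ (hdnn_towerGeom L m n η M a a'')) hl
      _ = (B₁ + B₂ + B₃) * (towerGeom L m n η M).len a * Real.exp (-(min δ₁ (min δ₂ δ₃) * (towerGeom L m n η M).dist a a'')) := by ring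
  · have h := h3 n η hηL c₀ c₁ hdiag m V1 0 le_rfl hα₃.le (fun _ => one_mem _) (norm_one_sub_one_le L m n η)
      (norm_one_sub_one_unshift_le L m n η) (fun _ => 0) (fun _ => le_rfl) (fun _ _ => by simp) (UlevOf_one_norm_sub_one_le L m n) (UlevOf_one_mem_U1 L m n)
      (star_one_eq_inv_one L m n) (norm_adTransportW_UlevOf_one_le L m n φ) hpos₁ M Rr H l
    refine hasMajorant_mono _ h fun a a'' => ?_
    have hl : 0 ≤ (towerGeom L m n η M).len a :=
      (B9Eq341TowerBlockGeometry.hlen_towerGeom L m n η M (by nlinarith [hηL, pow_pos (show (0 : ℝ) < L by exact_mod_cast Nat.pos_of_ne_zero (NeZero.ne L)) (n + 1)]) a).le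
    calc B₃ * (towerGeom L m n η M).len a * Real.exp (-(δ₃ * (towerGeom L m n η M).dist a a''))
        = (towerGeom L m n η M).len a * (B₃ * Real.exp (-(δ₃ * (towerGeom L m n η M).dist a a''))) := by ring
      _ ≤ (towerGeom L m n η M).len a * ((B₁ + B₂ + B₃) * Real.exp (-(min δ₁ (min δ₂ δ₃) * (towerGeom L m n η M).dist a a''))) :=
          mul_le_mul_of_nonneg_left (B4Sect5Proof.weaken hB₃.le (by linarith) hδm₃ (hdnn_towerGeom L m n η M a a'')) hl
      _ = (B₁ + B₂ + B₃) * (towerGeom L m n η M).len a * Real.exp (-(min δ₁ (min δ₂ δ₃) * (towerGeom L m n η M).dist a a'')) := by ring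

end Main

end Literature.MathematicalPhysics.QuantumFieldTheory.Balaban1983to89.B9Eq342TowerFlatBaseMajorants

end
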